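import Mathlib.Algebra.BigOperators.Ring.Finset
import Mathlib.Algebra.Group.Pointwise.Finset.Basic
import Mathlib.Tactic.Abel
import Mathlib.Tactic.Ring
import HarnessLib

/-!
# Affine invariance of the three-set line identity and of the cube symmetric form

ω-census `pub-omega`, family (b3), seat pub-omega-group gen 29.  Framing: lottery ticket; floor = certified bounds/negative
ranges.  VALUE: the kernel form of the normal form used by the three-set W-first engines (stage A runs over AFFINE classes
of shadows); NOT progress on ω.

The three-set line identity of `RadonProjection3.radon_identity₃` — for functions `w f g : B → R` on a finite abelian
group `B`, a point `s : B` and a constant `K`,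
`Σ_u Σ_v w(v)·(f(t−u+v) + f(v+u−t) + f(t+u−v))·g(u) + [s = t] = K` for every `t` —
is invariant under
* the common translation `w, f, g ↦ w(· − a), f(· − a), g(· − a)`, `s ↦ s + a` (`three_set_line_identity_translate`), and
* every automorphism `σ : B ≃+ B` pushed forward on all three functions, `s ↦ σ s` (`three_set_line_identity_map`).
Hence "`w` admits a solution `(f, g, s)`" is a union of orbits of the affine group `B ⋊ Aut B` (for `B = ℤ/p`: `AGL₁(𝔽_p)`,
order `p(p−1)`), which is the normal form enumerated by the engine `dom3aff` (`three_set_line_solvable_translate`,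
`three_set_line_solvable_map`).

On the two-dimensional side the same symmetry is `cube_symmetric_form_translate`: the conclusion of
`CubeSymmetricForm.cube_symmetric_form_of_law` for `(W, X, Y, x₀)` implies it for `(W + a, X + a, Y + a, x₀ + a)` — the three
signed sums `−w+x+y`, `w−x+y`, `w+x−y` all shift by `a`.
-/

namespace Summit.MatrixMultiplication.OmegaCensus

open Finset

section Line

variable {B : Type*} [AddCommGroup B] [Fintype B] {R : Type*} [CommSemiring R]

/-- The left-hand side of the three-set line identity (the trilinear form of `radon_identity₃`), as a function of `t`.
[folklore] -/
theorem three_set_line_lhs_translate (w f g : B → R) (a t : B) :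
    (∑ u : B, ∑ v : B, w (v - a) * (f (t - u + v - a) + f (v + u - t - a) + f (t + u - v - a)) * g (u - a)) =
      ∑ u : B, ∑ v : B, w v * (f (t - a - u + v) + f (v + u - (t - a)) + f (t - a + u - v)) * g u := by
  rw [← Equiv.sum_comp (Equiv.addRight a)]
  refine sum_congr rfl fun u _ => ?_
  rw [← Equiv.sum_comp (Equiv.addRight a)]
  refine sum_congr rfl fun v _ => ?_
  simp only [Equiv.coe_addRight, add_sub_cancel_right]
  have e₁ : t - (u + a) + (v + a) - a = t - a - u + v := by abel
  have e₂ : v + a + (u + a) - t - a = v + u - (t - a) := by abel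
  have e₃ : t + (u + a) - (v + a) - a = t - a + u - v := by abel
  rw [e₁, e₂, e₃]

/-- Reindexing the trilinear form along an automorphism `σ`. [folklore] -/
theorem three_set_line_lhs_map (σ : B ≃+ B) (w f g : B → R) (t : B) :
    (∑ u : B, ∑ v : B, w (σ.symm v) * (f (σ.symm (t - u + v)) + f (σ.symm (v + u - t)) + f (σ.symm (t + u - v))) *
        g (σ.symm u)) =
      ∑ u : B, ∑ v : B, w v * (f (σ.symm t - u + v) + f (v + u - σ.symm t) + f (σ.symm t + u - v)) * g u := by
  rw [← (σ : B ≃ B).sum_comp]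
  refine sum_congr rfl fun u _ => ?_
  rw [← (σ : B ≃ B).sum_comp]
  refine sum_congr rfl fun v _ => ?_
  simp only [AddEquiv.coe_toEquiv, AddEquiv.symm_apply_apply, map_add, map_sub]

variable [DecidableEq B]

/-- **Translation invariance of the three-set line identity**: if `(w, f, g, s)` satisfies
`Σ_u Σ_v w(v)(f(t−u+v)+f(v+u−t)+f(t+u−v))g(u) + [s = t] = K` for all `t`, then so does the common translate
`(w(·−a), f(·−a), g(·−a), s + a)`. [folklore] -/
theorem three_set_line_identity_translate {w f g : B → R} {s : B} {K : R}
    (h : ∀ t : B, (∑ u : B, ∑ v : B, w v * (f (t - u + v) + f (v + u - t) + f (t + u - v)) * g u) +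
      (if s = t then 1 else 0) = K) (a t : B) :
    (∑ u : B, ∑ v : B, w (v - a) * (f (t - u + v - a) + f (v + u - t - a) + f (t + u - v - a)) * g (u - a)) +
      (if s + a = t then 1 else 0) = K := by
  rw [three_set_line_lhs_translate]
  have hs : (s + a = t) ↔ (s = t - a) := by
    constructor
    · rintro rfl; abel
    · rintro rfl; abel
  simp only [hs]
  exact h (t - a)

/-- **Automorphism invariance of the three-set line identity**: pushing `(w, f, g)` forward along `σ : B ≃+ B`
(`w ↦ w ∘ σ⁻¹`, …) and `s ↦ σ s` preserves the identity. [folklore] -/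
theorem three_set_line_identity_map (σ : B ≃+ B) {w f g : B → R} {s : B} {K : R}
    (h : ∀ t : B, (∑ u : B, ∑ v : B, w v * (f (t - u + v) + f (v + u - t) + f (t + u - v)) * g u) +
      (if s = t then 1 else 0) = K) (t : B) :
    (∑ u : B, ∑ v : B, w (σ.symm v) * (f (σ.symm (t - u + v)) + f (σ.symm (v + u - t)) + f (σ.symm (t + u - v))) *
        g (σ.symm u)) + (if σ s = t then 1 else 0) = K := by
  rw [three_set_line_lhs_map]
  have hs : (σ s = t) ↔ (s = σ.symm t) := by
    constructor
    · rintro rfl; simp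
    · rintro rfl; simp
  simp only [hs]
  exact h (σ.symm t)

/-- **Admissibility is translation invariant.**  If `w` admits `(f, g, s)` solving the three-set line identity with
constant `K`, then the translate `w(· − a)` admits `(f(· − a), g(· − a), s + a)`.  (Nonnegativity / integrality side
conditions on `f, g` are properties of the value multiset and are preserved verbatim.) [folklore] -/
theorem three_set_line_solvable_translate {w : B → R} {K : R} (P : (B → R) → Prop)
    (hP : ∀ (h : B → R) (a : B), P h → P fun x => h (x - a))
    (h : ∃ (f g : B → R) (s : B), P f ∧ P g ∧ ∀ t : B,
      (∑ u : B, ∑ v : B, w v * (f (t - u + v) + f (v + u - t) + f (t + u - v)) * g u) +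
        (if s = t then 1 else 0) = K) (a : B) :
    ∃ (f g : B → R) (s : B), P f ∧ P g ∧ ∀ t : B,
      (∑ u : B, ∑ v : B, (fun x => w (x - a)) v * (f (t - u + v) + f (v + u - t) + f (t + u - v)) * g u) +
        (if s = t then 1 else 0) = K := by
  obtain ⟨f, g, s, hf, hg, hfg⟩ := h
  refine ⟨fun x => f (x - a), fun x => g (x - a), s + a, hP f a hf, hP g a hg, fun t => ?_⟩
  exact three_set_line_identity_translate hfg a t

/-- **Admissibility is invariant under automorphisms.**  If `w` admits `(f, g, s)`, then `w ∘ σ⁻¹` admits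
`(f ∘ σ⁻¹, g ∘ σ⁻¹, σ s)`. [folklore] -/
theorem three_set_line_solvable_map (σ : B ≃+ B) {w : B → R} {K : R} (P : (B → R) → Prop)
    (hP : ∀ h : B → R, P h → P fun x => h (σ.symm x))
    (h : ∃ (f g : B → R) (s : B), P f ∧ P g ∧ ∀ t : B,
      (∑ u : B, ∑ v : B, w v * (f (t - u + v) + f (v + u - t) + f (t + u - v)) * g u) +
        (if s = t then 1 else 0) = K) :
    ∃ (f g : B → R) (s : B), P f ∧ P g ∧ ∀ t : B,
      (∑ u : B, ∑ v : B, (fun x => w (σ.symm x)) v * (f (t - u + v) + f (v + u - t) + f (t + u - v)) * g u) +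
        (if s = t then 1 else 0) = K := by
  obtain ⟨f, g, s, hf, hg, hfg⟩ := h
  refine ⟨fun x => f (σ.symm x), fun x => g (σ.symm x), σ s, hP f hf, hP g hg, fun t => ?_⟩
  have := three_set_line_identity_map σ hfg t
  simpa only [map_add, map_sub] using this

end Line

section Plane

variable {A : Type*} [AddCommGroup A] [DecidableEq A]

/-- Translating all three sets by `a` translates the box `W ×ˢ X ×ˢ Y` by `(a, a, a)`. [folklore] -/
theorem product₃_image_add (W X Y : Finset A) (a : A) :
    (W.image (· + a)) ×ˢ (X.image (· + a)) ×ˢ (Y.image (· + a)) =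
      (W ×ˢ X ×ˢ Y).image fun p : A × A × A => (p.1 + a, p.2.1 + a, p.2.2 + a) := by
  ext ⟨w, x, y⟩
  simp only [mem_product, mem_image, Prod.mk.injEq]
  constructor
  · rintro ⟨⟨w', hw', rfl⟩, ⟨x', hx', rfl⟩, ⟨y', hy', rfl⟩⟩
    exact ⟨(w', x', y'), ⟨hw', hx', hy'⟩, rfl, rfl, rfl⟩
  · rintro ⟨⟨w', x', y'⟩, ⟨hw', hx', hy'⟩, rfl, rfl, rfl⟩
    exact ⟨⟨w', hw', rfl⟩, ⟨x', hx', rfl⟩, ⟨y', hy', rfl⟩⟩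

/-- A signed sum with coefficient sum `1` commutes with the common translation: generic transfer lemma for
injectivity. [folklore] -/
theorem injOn_signed_sum_translate {σ : A × A × A → A} (hσ : ∀ (p : A × A × A) (a : A),
      σ (p.1 + a, p.2.1 + a, p.2.2 + a) = σ p + a)
    {W X Y : Finset A} (h : Set.InjOn σ ↑(W ×ˢ X ×ˢ Y)) (a : A) :
    Set.InjOn σ ↑((W.image (· + a)) ×ˢ (X.image (· + a)) ×ˢ (Y.image (· + a))) := by
  rw [product₃_image_add, coe_image]
  rintro _ ⟨p, hp, rfl⟩ _ ⟨q, hq, rfl⟩ hpq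
  rw [hσ, hσ, add_left_inj] at hpq
  rw [h hp hq hpq]

/-- The image of the translated box under a signed sum with coefficient sum `1` is the translated image. [folklore] -/
theorem image_signed_sum_translate {σ : A × A × A → A} (hσ : ∀ (p : A × A × A) (a : A),
      σ (p.1 + a, p.2.1 + a, p.2.2 + a) = σ p + a) (W X Y : Finset A) (a : A) :
    ((W.image (· + a)) ×ˢ (X.image (· + a)) ×ˢ (Y.image (· + a))).image σ =
      ((W ×ˢ X ×ˢ Y).image σ).image (· + a) := by
  rw [product₃_image_add, image_image, image_image]
  exact image_congr fun p _ => hσ p a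

/-- Translation is injective on finsets: disjointness transfers. [folklore] -/
theorem disjoint_image_add_right {P Q : Finset A} (h : Disjoint P Q) (a : A) :
    Disjoint (P.image (· + a)) (Q.image (· + a)) :=
  disjoint_image (add_left_injective a) |>.2 h

variable [Fintype A]

/-- Translating `univ.erase x₀` gives `univ.erase (x₀ + a)`. [folklore] -/
theorem image_add_univ_erase (x₀ a : A) : (univ.erase x₀).image (· + a) = univ.erase (x₀ + a) := by
  ext z
  simp only [mem_image, mem_erase, mem_univ, and_true, ne_eq]
  constructor
  · rintro ⟨y, hy, rfl⟩
    exact fun h => hy (add_right_cancel h)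
  · intro hz
    exact ⟨z - a, fun h => hz (by rw [← h, sub_add_cancel]), sub_add_cancel z a⟩

/-- **Translation invariance of the cube symmetric form.**  If `(W, X, Y, x₀)` satisfies the conclusion of
`cube_symmetric_form_of_law` (the three signed sums `−w+x+y`, `w−x+y`, `w+x−y` are injective on `W × X × Y`, with
pairwise disjoint images covering `A ∖ {x₀}`), then so does `(W + a, X + a, Y + a, x₀ + a)`: each signed sum has
coefficient sum `1`, so all three images shift by `a`. [folklore] -/
theorem cube_symmetric_form_translate {W X Y : Finset A} {x₀ : A}
    (h₁ : Set.InjOn (fun p : A × A × A => -p.1 + p.2.1 + p.2.2) ↑(W ×ˢ X ×ˢ Y))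
    (h₂ : Set.InjOn (fun p : A × A × A => p.1 - p.2.1 + p.2.2) ↑(W ×ˢ X ×ˢ Y))
    (h₃ : Set.InjOn (fun p : A × A × A => p.1 + p.2.1 - p.2.2) ↑(W ×ˢ X ×ˢ Y))
    (d₁₂ : Disjoint ((W ×ˢ X ×ˢ Y).image fun p : A × A × A => -p.1 + p.2.1 + p.2.2)
      ((W ×ˢ X ×ˢ Y).image fun p : A × A × A => p.1 - p.2.1 + p.2.2))
    (d₁₃ : Disjoint ((W ×ˢ X ×ˢ Y).image fun p : A × A × A => -p.1 + p.2.1 + p.2.2)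
      ((W ×ˢ X ×ˢ Y).image fun p : A × A × A => p.1 + p.2.1 - p.2.2))
    (d₂₃ : Disjoint ((W ×ˢ X ×ˢ Y).image fun p : A × A × A => p.1 - p.2.1 + p.2.2)
      ((W ×ˢ X ×ˢ Y).image fun p : A × A × A => p.1 + p.2.1 - p.2.2))
    (hcover : ((W ×ˢ X ×ˢ Y).image fun p : A × A × A => -p.1 + p.2.1 + p.2.2) ∪
      ((W ×ˢ X ×ˢ Y).image fun p : A × A × A => p.1 - p.2.1 + p.2.2) ∪
      ((W ×ˢ X ×ˢ Y).image fun p : A × A × A => p.1 + p.2.1 - p.2.2) = univ.erase x₀) (a : A) :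
    let W' := W.image (· + a)
    let X' := X.image (· + a)
    let Y' := Y.image (· + a)
    Set.InjOn (fun p : A × A × A => -p.1 + p.2.1 + p.2.2) ↑(W' ×ˢ X' ×ˢ Y') ∧
    Set.InjOn (fun p : A × A × A => p.1 - p.2.1 + p.2.2) ↑(W' ×ˢ X' ×ˢ Y') ∧
    Set.InjOn (fun p : A × A × A => p.1 + p.2.1 - p.2.2) ↑(W' ×ˢ X' ×ˢ Y') ∧
    Disjoint ((W' ×ˢ X' ×ˢ Y').image fun p : A × A × A => -p.1 + p.2.1 + p.2.2)
      ((W' ×ˢ X' ×ˢ Y').image fun p : A × A × A => p.1 - p.2.1 + p.2.2) ∧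
    Disjoint ((W' ×ˢ X' ×ˢ Y').image fun p : A × A × A => -p.1 + p.2.1 + p.2.2)
      ((W' ×ˢ X' ×ˢ Y').image fun p : A × A × A => p.1 + p.2.1 - p.2.2) ∧
    Disjoint ((W' ×ˢ X' ×ˢ Y').image fun p : A × A × A => p.1 - p.2.1 + p.2.2)
      ((W' ×ˢ X' ×ˢ Y').image fun p : A × A × A => p.1 + p.2.1 - p.2.2) ∧
    ((W' ×ˢ X' ×ˢ Y').image fun p : A × A × A => -p.1 + p.2.1 + p.2.2) ∪
      ((W' ×ˢ X' ×ˢ Y').image fun p : A × A × A => p.1 - p.2.1 + p.2.2) ∪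
      ((W' ×ˢ X' ×ˢ Y').image fun p : A × A × A => p.1 + p.2.1 - p.2.2) = univ.erase (x₀ + a) ∧
    W'.card = W.card ∧ X'.card = X.card ∧ Y'.card = Y.card := by
  intro W' X' Y'
  have hσ₁ : ∀ (p : A × A × A) (a : A),
      (fun p : A × A × A => -p.1 + p.2.1 + p.2.2) (p.1 + a, p.2.1 + a, p.2.2 + a) =
        (fun p : A × A × A => -p.1 + p.2.1 + p.2.2) p + a := fun p a => by simp only; abel
  have hσ₂ : ∀ (p : A × A × A) (a : A),
      (fun p : A × A × A => p.1 - p.2.1 + p.2.2) (p.1 + a, p.2.1 + a, p.2.2 + a) =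
        (fun p : A × A × A => p.1 - p.2.1 + p.2.2) p + a := fun p a => by simp only; abel
  have hσ₃ : ∀ (p : A × A × A) (a : A),
      (fun p : A × A × A => p.1 + p.2.1 - p.2.2) (p.1 + a, p.2.1 + a, p.2.2 + a) =
        (fun p : A × A × A => p.1 + p.2.1 - p.2.2) p + a := fun p a => by simp only; abel
  refine ⟨injOn_signed_sum_translate hσ₁ h₁ a, injOn_signed_sum_translate hσ₂ h₂ a,
    injOn_signed_sum_translate hσ₃ h₃ a, ?_, ?_, ?_, ?_, card_image_of_injective _ (add_left_injective a),
    card_image_of_injective _ (add_left_injective a), card_image_of_injective _ (add_left_injective a)⟩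
  · rw [image_signed_sum_translate hσ₁, image_signed_sum_translate hσ₂]; exact disjoint_image_add_right d₁₂ a
  · rw [image_signed_sum_translate hσ₁, image_signed_sum_translate hσ₃]; exact disjoint_image_add_right d₁₃ a
  · rw [image_signed_sum_translate hσ₂, image_signed_sum_translate hσ₃]; exact disjoint_image_add_right d₂₃ a
  · rw [image_signed_sum_translate hσ₁, image_signed_sum_translate hσ₂, image_signed_sum_translate hσ₃,
      ← image_union, ← image_union, hcover, image_add_univ_erase]

end Plane

end Summit.MatrixMultiplication.OmegaCensus
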